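import Summits.QuantumFields.YangMills.Theorems.SmallCircleAnchorAnchorGapStubDebyeScreening7
import Summits.QuantumFields.YangMills.Theorems.SmallCircleAnchorAnchorGapStubDebyeScreening8

/-!
# Crux `AnchorGap` (stmt-QuantumFields-11141), line `registered` — removal of the regulator at fixed volume (step M-c under stub DSred)

Stub DSred (`stub_debyeScreening`, reduced form; skeleton `Cruxes/AnchorGap/Lines/birth.lean`) has the
quantifier order `∀ N, ∃ ε₀(N)`: the regulator `ε` of the lattice sine-Gordon measure
(`Literature.Probability.LatticeModels.LatticeSineGordon`) is removed at FIXED volume, where the limit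
object is the neutral gas with compact zero mode.  This file closes that soft step in a form that
needs no `ε = 0` measure: with the commensurate basis `b` of the dual lattice, the zero-mode cell
`S = {φ | θ̄(φ) ∈ D_b}` and the flat reference weight
`W = weight · e^{(2g²)⁻¹ ε V⁻¹ Σ_a (Σ_x φ(x,a))²} = exp(−(2g²)⁻¹[‖∇φ‖² + ε‖φ − θ̄‖²] + tilt)`,

* `measurableSet_zeroModeCell`, `zeroModeCell_normSq_le`, `integrable_indicator_flatWeight` — the
  cell is measurable, the zero mode is bounded on it, `1_S W` is integrable (`g ≠ 0`, `ε > 0`);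
* `expect_sub_flatExpect_le` — **M-c**: for every `δ > 0` there is `a₀(k, b, δ) > 0` such that
  `|⟨H⟩_ε − ∫ 1_S H W / ∫ 1_S W| ≤ δ` for all tori, all charge families dual to `b`, all `g ≠ 0`, `ζ`,
  all `ε` with `ε V ≤ a₀ g²`, and all measurable `|H| ≤ 1` invariant under the constant dual shifts.

Proof of M-c: the exact folding `integral_mul_weight_fold_flat` (`…StubDebyeScreening8`) expresses
`⟨H⟩_ε` as the `1_S W Θ_a(θ̄)`-average with `a = εV/g²`; `latticeTheta_flat` (`…7`) pins `Θ_a` on `D_b`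
within a factor `(1 + δ')^{±1}` of `Θ_a(0)`; an abstract two-weight comparison (`m f₀ ≤ f₁ ≤ M f₀ ⇒`
normalised averages of `|H| ≤ 1` differ by `≤ 2(M − m)/m`) finishes.  Consequence for DSred: it is
equivalent (constants `C ↦ 2C`) to the same clustering statement for the flat reference ensemble,
which is the honest remaining core (the Brydges-type expansion, uniform in `N`).
-/

set_option autoImplicit false

noncomputable section

namespace Summit.QuantumFields.YangMills.Theorems.AnchorGap

open MeasureTheory Finset
open Literature.Probability.LatticeModels

/-- **The zero-mode cell is measurable.** `{φ | θ̄(φ) ∈ D_b}` is the preimage of the fundamental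
cell of the basis `b` (`ZSpan.fundamentalDomain`) under the continuous zero-mode map
`θ̄(φ) = V⁻¹ Σ_x φ(x,·)`. [folklore] -/
theorem measurableSet_zeroModeCell :
    ∀ (d N k : ℕ) [NeZero N] (b : Fin k → Fin k → ℝ), LinearIndependent ℝ b → MeasurableSet {φ : LatticeSineGordon.Config d N k | ∃ t : Fin k → ℝ, (∀ j : Fin k, 0 ≤ t j ∧ t j < 1) ∧ ∀ a : Fin k, (Fintype.card (TorusSite d N) : ℝ)⁻¹ * ∑ x : TorusSite d N, φ (x, a) = ∑ j : Fin k, t j * b j a} := by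
  intro d N k _ b hb
  classical
  let B := basisOfPiSpaceOfLinearIndependent hb
  have hB : ⇑B = b := coe_basisOfPiSpaceOfLinearIndependent hb
  set θb : LatticeSineGordon.Config d N k → Fin k → ℝ :=
    fun φ c => (Fintype.card (TorusSite d N) : ℝ)⁻¹ * ∑ x, φ (x, c) with hθb
  have hD : ∀ θ : Fin k → ℝ, (∃ t : Fin k → ℝ, (∀ j : Fin k, 0 ≤ t j ∧ t j < 1) ∧
      ∀ a : Fin k, θ a = ∑ j : Fin k, t j * b j a) ↔ θ ∈ ZSpan.fundamentalDomain B := by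
    intro θ
    rw [ZSpan.mem_fundamentalDomain]
    constructor
    · rintro ⟨t, ht, hθt⟩ i
      have hθ : θ = ∑ j, t j • B j := by
        funext a
        rw [hθt a, Finset.sum_apply]
        simp [hB, smul_eq_mul]
      rw [hθ, Module.Basis.repr_sum_self]
      exact ⟨(ht i).1, (ht i).2⟩
    · intro h
      refine ⟨fun j => B.repr θ j, fun j => ⟨(h j).1, (h j).2⟩, fun a => ?_⟩
      conv_lhs => rw [← B.sum_repr θ]
      rw [Finset.sum_apply]
      simp [hB, smul_eq_mul]
  have hSpre : {φ : LatticeSineGordon.Config d N k | ∃ t : Fin k → ℝ, (∀ j : Fin k, 0 ≤ t j ∧ t j < 1) ∧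
      ∀ a : Fin k, (Fintype.card (TorusSite d N) : ℝ)⁻¹ * ∑ x : TorusSite d N, φ (x, a) = ∑ j : Fin k, t j * b j a} =
      θb ⁻¹' ZSpan.fundamentalDomain B := by
    ext φ
    simp only [Set.mem_setOf_eq, Set.mem_preimage]
    exact hD (θb φ)
  have hθb_cont : Continuous θb := by
    rw [hθb]; fun_prop
  rw [hSpre]
  exact measurableSet_preimage hθb_cont.measurable (ZSpan.fundamentalDomain_measurableSet B)

/-- **On the zero-mode cell the zero mode is bounded**: if `θ̄(φ) = Σ_j t_j b_j` with `t ∈ [0,1)ᵏ`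
then `|θ̄(φ)|² ≤ Σ_c (Σ_j |b_j c|)²`. [folklore] -/
theorem zeroModeCell_normSq_le :
    ∀ (d N k : ℕ) [NeZero N] (b : Fin k → Fin k → ℝ) (φ : LatticeSineGordon.Config d N k), φ ∈ {φ : LatticeSineGordon.Config d N k | ∃ t : Fin k → ℝ, (∀ j : Fin k, 0 ≤ t j ∧ t j < 1) ∧ ∀ a : Fin k, (Fintype.card (TorusSite d N) : ℝ)⁻¹ * ∑ x : TorusSite d N, φ (x, a) = ∑ j : Fin k, t j * b j a} → ∑ c : Fin k, ((Fintype.card (TorusSite d N) : ℝ)⁻¹ * ∑ x : TorusSite d N, φ (x, c)) ^ 2 ≤ ∑ c : Fin k, (∑ j : Fin k, |b j c|) ^ 2 := by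
  rintro d N k _ b φ ⟨t, ht, hθ⟩
  refine sum_le_sum fun c _ => ?_
  rw [hθ c]
  have habs : |∑ j, t j * b j c| ≤ ∑ j, |b j c| := by
    refine (abs_sum_le_sum_abs _ _).trans (sum_le_sum fun j _ => ?_)
    rw [abs_mul, abs_of_nonneg (ht j).1]
    exact mul_le_of_le_one_left (abs_nonneg _) (ht j).2.le
  calc (∑ j, t j * b j c) ^ 2 = |∑ j, t j * b j c| ^ 2 := (sq_abs _).symm
    _ ≤ (∑ j, |b j c|) ^ 2 := pow_le_pow_left₀ (abs_nonneg _) habs 2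

/-- **The flat reference weight is integrable on the zero-mode cell.** On `{θ̄ ∈ D_b}` the factor
`e^{(2g²)⁻¹ ε V⁻¹ Σ_a (Σ_x φ)²} = e^{(2g²)⁻¹ ε V |θ̄|²}` is bounded by `e^{(2g²)⁻¹ ε V B}`,
`B = Σ_c (Σ_j |b_j c|)²`, so `1_{D_b}(θ̄) · W ≤ e^{(2g²)⁻¹ ε V B} · weight`, which is integrable for
`g ≠ 0`, `ε > 0` (`LatticeSineGordon.integrable_weight`). [folklore] -/
theorem integrable_indicator_flatWeight :
    ∀ (d N k : ℕ) [NeZero N] (ι : Type) [Fintype ι] (α : ι → Fin k → ℝ) (b : Fin k → Fin k → ℝ), LinearIndependent ℝ b → ∀ (g ε ζ : ℝ), g ≠ 0 → 0 < ε → Integrable ({φ : LatticeSineGordon.Config d N k | ∃ t : Fin k → ℝ, (∀ j : Fin k, 0 ≤ t j ∧ t j < 1) ∧ ∀ a : Fin k, (Fintype.card (TorusSite d N) : ℝ)⁻¹ * ∑ x : TorusSite d N, φ (x, a) = ∑ j : Fin k, t j * b j a}.indicator (fun φ => LatticeSineGordon.weight α g ε ζ φ * Real.exp ((2 * g ^ 2)⁻¹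 * (ε * ((Fintype.card (TorusSite d N) : ℝ)⁻¹ * ∑ a : Fin k, (∑ x : TorusSite d N, φ (x, a)) ^ 2))))) := by
  intro d N k _ ι _ α b hb g ε ζ hg hε
  set S : Set (LatticeSineGordon.Config d N k) := {φ | ∃ t : Fin k → ℝ, (∀ j : Fin k, 0 ≤ t j ∧ t j < 1) ∧
    ∀ a : Fin k, (Fintype.card (TorusSite d N) : ℝ)⁻¹ * ∑ x : TorusSite d N, φ (x, a) = ∑ j : Fin k, t j * b j a} with hS
  set V : ℝ := (Fintype.card (TorusSite d N) : ℝ) with hV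
  have hVpos : 0 < V := by
    rw [hV]; exact_mod_cast Fintype.card_pos
  set Bc : ℝ := ∑ c : Fin k, (∑ j : Fin k, |b j c|) ^ 2 with hBc
  have hSmeas : MeasurableSet S := measurableSet_zeroModeCell d N k b hb
  have hWcont : Continuous (fun φ : LatticeSineGordon.Config d N k => LatticeSineGordon.weight α g ε ζ φ *
      Real.exp ((2 * g ^ 2)⁻¹ * (ε * (V⁻¹ * ∑ a : Fin k, (∑ x : TorusSite d N, φ (x, a)) ^ 2)))) := by
    have := LatticeSineGordon.continuous_weight (d := d) (N := N) α g ε ζ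
    fun_prop
  refine Integrable.mono' ((LatticeSineGordon.integrable_weight (d := d) (N := N) α hg hε ζ).const_mul
    (Real.exp ((2 * g ^ 2)⁻¹ * (ε * (V * Bc))))) ((hWcont.measurable.indicator hSmeas).aestronglyMeasurable)
    (Filter.Eventually.of_forall fun φ => ?_)
  by_cases hφ : φ ∈ S
  · rw [Set.indicator_of_mem hφ, Real.norm_eq_abs, abs_of_pos (mul_pos (LatticeSineGordon.weight_pos _ _ _ _ _) (Real.exp_pos _)), mul_comm]
    refine mul_le_mul_of_nonneg_right (Real.exp_le_exp.2 ?_) (LatticeSineGordon.weight_pos _ _ _ _ _).le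
    have hθ := zeroModeCell_normSq_le d N k b φ hφ
    have hsq : V⁻¹ * ∑ a : Fin k, (∑ x : TorusSite d N, φ (x, a)) ^ 2 =
        V * ∑ c : Fin k, (V⁻¹ * ∑ x : TorusSite d N, φ (x, c)) ^ 2 := by
      rw [mul_sum, mul_sum]
      refine sum_congr rfl fun c _ => ?_
      field_simp
    rw [hsq]
    have hg2 : 0 < (2 * g ^ 2)⁻¹ := by positivity
    exact mul_le_mul_of_nonneg_left (mul_le_mul_of_nonneg_left
      (mul_le_mul_of_nonneg_left hθ hVpos.le) hε.le) hg2.le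
  · rw [Set.indicator_of_notMem hφ, norm_zero]
    exact mul_nonneg (Real.exp_pos _).le (LatticeSineGordon.weight_pos _ _ _ _ _).le

/-- Abstract two-weight comparison: if `m f₀ ≤ f₁ ≤ M f₀` pointwise (`m > 0`, `f₀ ≥ 0`), then the
normalised `f₁`- and `f₀`-averages of any `|H| ≤ 1` differ by at most `2(M − m)/m`. -/
private lemma ratio_perturb_le {X : Type*} [MeasurableSpace X] (μ : Measure X) (f₀ f₁ H : X → ℝ)
    (m M : ℝ) (hm : 0 < m) (hf₀ : ∀ x, 0 ≤ f₀ x) (hb : ∀ x, m * f₀ x ≤ f₁ x ∧ f₁ x ≤ M * f₀ x)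
    (hi₀ : Integrable f₀ μ) (hi₁ : Integrable f₁ μ) (hH : AEStronglyMeasurable H μ)
    (hH1 : ∀ x, |H x| ≤ 1) (hZ₀ : 0 < ∫ x, f₀ x ∂μ) :
    |(∫ x, H x * f₁ x ∂μ) / (∫ x, f₁ x ∂μ) - (∫ x, H x * f₀ x ∂μ) / (∫ x, f₀ x ∂μ)| ≤
      2 * (M - m) / m := by
  set Z₀ := ∫ x, f₀ x ∂μ with hZ₀def
  set Z₁ := ∫ x, f₁ x ∂μ with hZ₁def
  have hZ₁lo : m * Z₀ ≤ Z₁ := by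
    rw [hZ₀def, ← integral_const_mul]
    exact integral_mono (hi₀.const_mul m) hi₁ fun x => (hb x).1
  have hZ₁hi : Z₁ ≤ M * Z₀ := by
    rw [hZ₀def, ← integral_const_mul]
    exact integral_mono hi₁ (hi₀.const_mul M) fun x => (hb x).2
  have hZ₁pos : 0 < Z₁ := lt_of_lt_of_le (mul_pos hm hZ₀) hZ₁lo
  have hmM : m ≤ M := le_of_mul_le_mul_right (hZ₁lo.trans hZ₁hi) hZ₀
  have hHn : ∀ᵐ x ∂μ, ‖H x‖ ≤ 1 := Filter.Eventually.of_forall fun x => by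
    rw [Real.norm_eq_abs]; exact hH1 x
  have hiH₀ : Integrable (fun x => H x * f₀ x) μ := hi₀.bdd_mul hH hHn
  have hiH₁ : Integrable (fun x => H x * f₁ x) μ := hi₁.bdd_mul hH hHn
  set c : ℝ := (∫ x, H x * f₀ x ∂μ) / Z₀ with hcdef
  have hc1 : |c| ≤ 1 := by
    rw [hcdef, abs_div, abs_of_pos hZ₀, div_le_one hZ₀]
    calc |∫ x, H x * f₀ x ∂μ| ≤ ∫ x, |H x * f₀ x| ∂μ := abs_integral_le_integral_abs
      _ ≤ ∫ x, f₀ x ∂μ := integral_mono hiH₀.abs hi₀ fun x => by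
          simp only []
          rw [abs_mul, abs_of_nonneg (hf₀ x)]
          exact mul_le_of_le_one_left (hf₀ x) (hH1 x)
  have hcZ : c * Z₀ = ∫ x, H x * f₀ x ∂μ := div_mul_cancel₀ _ hZ₀.ne'
  -- key identity
  have hkey : (∫ x, H x * f₁ x ∂μ) - c * Z₁ = ∫ x, (H x - c) * (f₁ x - m * f₀ x) ∂μ := by
    have hexp : ∀ x, (H x - c) * (f₁ x - m * f₀ x) =
        (H x * f₁ x - c * f₁ x) - (m * (H x * f₀ x) - c * m * f₀ x) := by
      intro x; ring
    simp_rw [hexp]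
    have hA : Integrable (fun x => H x * f₁ x - c * f₁ x) μ := hiH₁.sub (hi₁.const_mul c)
    have hB : Integrable (fun x => m * (H x * f₀ x) - c * m * f₀ x) μ :=
      (hiH₀.const_mul m).sub (hi₀.const_mul (c * m))
    rw [integral_sub hA hB, integral_sub hiH₁ (hi₁.const_mul c),
      integral_sub (hiH₀.const_mul m) (hi₀.const_mul (c * m)),
      integral_const_mul, integral_const_mul, integral_const_mul, ← hcZ]
    ring
  -- bound on the key integral
  have hbound : |∫ x, (H x - c) * (f₁ x - m * f₀ x) ∂μ| ≤ 2 * (Z₁ - m * Z₀) := by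
    have hi2 : Integrable (fun x => 2 * (f₁ x - m * f₀ x)) μ := (hi₁.sub (hi₀.const_mul m)).const_mul 2
    have hi3 : Integrable (fun x => (H x - c) * (f₁ x - m * f₀ x)) μ := by
      have : (fun x => (H x - c) * (f₁ x - m * f₀ x)) =
          fun x => (H x * f₁ x - c * f₁ x) - (m * (H x * f₀ x) - c * m * f₀ x) := by
        funext x; ring
      rw [this]
      have hA : Integrable (fun x => H x * f₁ x - c * f₁ x) μ := hiH₁.sub (hi₁.const_mul c)
      have hB : Integrable (fun x => m * (H x * f₀ x) - c * m * f₀ x) μ :=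
        (hiH₀.const_mul m).sub (hi₀.const_mul (c * m))
      exact hA.sub hB
    calc |∫ x, (H x - c) * (f₁ x - m * f₀ x) ∂μ| ≤ ∫ x, |(H x - c) * (f₁ x - m * f₀ x)| ∂μ :=
          abs_integral_le_integral_abs
      _ ≤ ∫ x, 2 * (f₁ x - m * f₀ x) ∂μ := by
          refine integral_mono hi3.abs hi2 fun x => ?_
          simp only []
          have h1 : |H x - c| ≤ 2 := by
            calc |H x - c| ≤ |H x| + |c| := abs_sub _ _
              _ ≤ 1 + 1 := add_le_add (hH1 x) hc1
              _ = 2 := by norm_num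
          have h2 : 0 ≤ f₁ x - m * f₀ x := by linarith [(hb x).1]
          rw [abs_mul, abs_of_nonneg h2]
          exact mul_le_mul_of_nonneg_right h1 h2
      _ = 2 * (Z₁ - m * Z₀) := by
          rw [integral_const_mul, integral_sub hi₁ (hi₀.const_mul m), integral_const_mul]
  -- conclude
  have hrew : (∫ x, H x * f₁ x ∂μ) / Z₁ - c = ((∫ x, H x * f₁ x ∂μ) - c * Z₁) / Z₁ := by
    field_simp
  rw [hrew, hkey, abs_div, abs_of_pos hZ₁pos, div_le_iff₀ hZ₁pos]
  calc |∫ x, (H x - c) * (f₁ x - m * f₀ x) ∂μ| ≤ 2 * (Z₁ - m * Z₀) := hbound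
    _ ≤ 2 * ((M - m) * Z₀) := by nlinarith [hZ₁hi]
    _ ≤ 2 * ((M - m) * (Z₁ / m)) := by
        have : Z₀ ≤ Z₁ / m := by rw [le_div_iff₀ hm]; linarith
        nlinarith [sub_nonneg.2 hmM]
    _ = 2 * (M - m) / m * Z₁ := by
        field_simp


/-- **Removal of the regulator at fixed volume (soft step M-c of stub DSred), quantitative form.**
For a basis `b` of `ℝᵏ` and `δ > 0` there is `a₀ = a₀(k, b, δ) > 0` such that for every torus,
every charge family dual to `b`, all `g ≠ 0`, `ζ`, and all regulators with `ε V ≤ a₀ g²`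
(`V = #sites`), every measurable `|H| ≤ 1` invariant under the constant shifts `φ ↦ φ + Σ_j n_j b_j`
satisfies `|⟨H⟩_ε − ⟨H⟩^flat_ε| ≤ δ`, where `⟨H⟩^flat_ε = ∫_{θ̄ ∈ D_b} H W / ∫_{θ̄ ∈ D_b} W` is the
expectation in the FLAT reference ensemble (`W = weight · e^{(2g²)⁻¹ ε V |θ̄|²}`: compact zero mode
`θ̄ ∈ D_b` with flat prior, mass `ε` on the non-constant modes only).  Proof: the exact folding
`integral_mul_weight_fold_flat` writes `⟨H⟩_ε` as the `W Θ_a(θ̄)`-average of `H` with `a = εV/g²`,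
`latticeTheta_flat` pins `Θ_a(θ̄)` on `D_b` between `Θ_a(0)/(1+δ')` and `(1+δ')Θ_a(0)`, and a
two-weight comparison bounds the difference of normalised averages by `2((1+δ')² − 1) ≤ δ`.
No `ε = 0` object, no uniformity issue: the bound depends on `(k, b, δ)` and `εV/g²` only. [folklore] -/
theorem expect_sub_flatExpect_le :
    ∀ (k : ℕ) (b : Fin k → Fin k → ℝ), LinearIndependent ℝ b → ∀ δ : ℝ, 0 < δ → ∃ a₀ : ℝ, 0 < a₀ ∧ ∀ (d N : ℕ) [NeZero N] (ι : Type) [Fintype ι] (α : ι → Fin k → ℝ), (∀ (j : Fin k) (r : ι), ∃ z : ℤ, ∑ a : Fin k, α r a * b j a = 2 * Real.pi * z) → ∀ (g ε ζ : ℝ), g ≠ 0 → 0 < ε → ε * Fintype.card (TorusSite d N) ≤ a₀ * g ^ 2 → ∀ (H : LatticeSineGordon.Config d N k → ℝ), Measurable H → (∀ φ, |H φ| ≤ 1) → (∀ (φ : LatticeSineGordon.Config d N k) (n : Fin k → ℤ), H (fun p => φ p + ∑ j : Fin k, (n j : ℝ) * b j p.2) = H φ) → let S : Set (LatticeSineGordon.Config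 d N k) := {φ | ∃ t : Fin k → ℝ, (∀ j : Fin k, 0 ≤ t j ∧ t j < 1) ∧ ∀ a : Fin k, (Fintype.card (TorusSite d N) : ℝ)⁻¹ * ∑ x : TorusSite d N, φ (x, a) = ∑ j : Fin k, t j * b j a}; let W : LatticeSineGordon.Config d N k → ℝ := fun φ => LatticeSineGordon.weight α g ε ζ φ * Real.exp ((2 * g ^ 2)⁻¹ * (ε * ((Fintype.card (TorusSite d N) : ℝ)⁻¹ * ∑ a : Fin k, (∑ x : TorusSite d N, φ (x, a)) ^ 2))); |LatticeSineGordon.expect α g ε ζ H - (∫ φ, S.indicator (fun φ => H φ * W φ) φ) / ∫ φ, S.indicator W φ| ≤ δ := by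
  intro k b hb δ hδ
  set Bc : ℝ := ∑ c : Fin k, (∑ j : Fin k, |b j c|) ^ 2 with hBc
  have hBc0 : 0 ≤ Bc := sum_nonneg fun c _ => sq_nonneg _
  -- flatness of the zero-mode prior at relative precision `δ' = min δ 8 / 8`
  set δ' : ℝ := min δ 8 / 8 with hδ'
  have hδ'pos : 0 < δ' := by rw [hδ']; positivity
  have hδ'le : δ' ≤ 1 := by
    rw [hδ', div_le_one (by norm_num : (0 : ℝ) < 8)]; exact min_le_right _ _
  have hδ'δ : 8 * δ' ≤ δ := by
    rw [hδ']; linarith [min_le_left δ 8]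
  obtain ⟨a₀, ha₀, hflat⟩ := latticeTheta_flat k b hb (Real.sqrt Bc) δ' hδ'pos
  refine ⟨a₀, ha₀, ?_⟩
  intro d N _ ι _ α hcomm g ε ζ hg hε hεa H hHm hH1 hHper S W
  -- volume and theta parameter
  set V : ℝ := (Fintype.card (TorusSite d N) : ℝ) with hV
  have hVpos : 0 < V := by
    rw [hV]; exact_mod_cast Fintype.card_pos
  have hg2 : 0 < g ^ 2 := lt_of_le_of_ne (sq_nonneg g) (Ne.symm (pow_ne_zero 2 hg))
  set a : ℝ := ε * V / g ^ 2 with ha_def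
  have ha : 0 < a := by rw [ha_def]; positivity
  have haa : a ≤ a₀ := by rw [ha_def, div_le_iff₀ hg2]; exact hεa
  -- the theta prior along the zero mode, and its value at the origin
  set Θ : LatticeSineGordon.Config d N k → ℝ := fun φ => ∑' n : Fin k → ℤ,
    Real.exp (-(a / 2) * ∑ c : Fin k, (V⁻¹ * ∑ x : TorusSite d N, φ (x, c) + ∑ j : Fin k, (n j : ℝ) * b j c) ^ 2)
    with hΘ
  set Θ₀ : ℝ := ∑' n : Fin k → ℤ,
    Real.exp (-(a / 2) * ∑ c : Fin k, ((0 : Fin k → ℝ) c + ∑ j : Fin k, (n j : ℝ) * b j c) ^ 2) with hΘ₀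
  have hΘ₀pos : 0 < Θ₀ := latticeTheta_pos k b hb a ha 0
  have hsq : Real.sqrt Bc ^ 2 = Bc := Real.sq_sqrt hBc0
  have h0R : ∑ c : Fin k, (0 : Fin k → ℝ) c ^ 2 ≤ Real.sqrt Bc ^ 2 := by
    simp [hsq, hBc0]
  have hSR : ∀ φ ∈ S, ∑ c : Fin k, (V⁻¹ * ∑ x : TorusSite d N, φ (x, c)) ^ 2 ≤ Real.sqrt Bc ^ 2 := by
    intro φ hφ
    rw [hsq]
    exact zeroModeCell_normSq_le d N k b φ hφ
  have hup : ∀ φ ∈ S, Θ φ ≤ (1 + δ') * Θ₀ := fun φ hφ =>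
    hflat a ha haa (fun c => V⁻¹ * ∑ x : TorusSite d N, φ (x, c)) 0 (hSR φ hφ) h0R
  have hlo : ∀ φ ∈ S, Θ₀ ≤ (1 + δ') * Θ φ := fun φ hφ =>
    hflat a ha haa 0 (fun c => V⁻¹ * ∑ x : TorusSite d N, φ (x, c)) h0R (hSR φ hφ)
  -- the two weights
  have hSmeas : MeasurableSet S := measurableSet_zeroModeCell d N k b hb
  have hi₀ : Integrable (S.indicator W) := integrable_indicator_flatWeight d N k ι α b hb g ε ζ hg hε
  have hWpos : ∀ φ, 0 < W φ := fun φ => mul_pos (LatticeSineGordon.weight_pos _ _ _ _ _) (Real.exp_pos _)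
  set f₁ : LatticeSineGordon.Config d N k → ℝ := S.indicator (fun φ => W φ * Θ φ) with hf₁
  -- the folding identities
  have hfoldH := integral_mul_weight_fold_flat d N k ι α b hb hcomm g ε ζ hg hε H hHm 1 hH1 hHper
  have hfold1 := integral_mul_weight_fold_flat d N k ι α b hb hcomm g ε ζ hg hε (fun _ => (1 : ℝ))
    measurable_const 1 (fun _ => by simp) (fun _ _ => rfl)
  have hnum : ∫ φ, H φ * LatticeSineGordon.weight α g ε ζ φ = ∫ φ, H φ * f₁ φ := by
    rw [hfoldH]
    refine integral_congr_ae (Filter.Eventually.of_forall fun φ => ?_)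
    show S.indicator (fun φ => H φ * W φ * Θ φ) φ = H φ * S.indicator (fun φ => W φ * Θ φ) φ
    rw [← Set.indicator_mul_right]
    simp only [mul_assoc]
  have hden : ∫ φ : LatticeSineGordon.Config d N k, LatticeSineGordon.weight α g ε ζ φ = ∫ φ, f₁ φ := by
    have : (fun φ : LatticeSineGordon.Config d N k => LatticeSineGordon.weight α g ε ζ φ) =
        fun φ => (fun _ => (1 : ℝ)) φ * LatticeSineGordon.weight α g ε ζ φ := by
      funext φ; simp
    rw [this, hfold1]
    refine integral_congr_ae (Filter.Eventually.of_forall fun φ => ?_)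
    show S.indicator (fun φ => 1 * W φ * Θ φ) φ = S.indicator (fun φ => W φ * Θ φ) φ
    simp only [one_mul]
  -- integrability of `f₁` and positivity of the partition functions
  have hZ : 0 < ∫ φ, f₁ φ := by
    rw [← hden]
    exact LatticeSineGordon.partitionFunction_pos (d := d) (N := N) α hg hε ζ
  have hi₁ : Integrable f₁ := by
    by_contra h
    rw [integral_undef h] at hZ
    exact lt_irrefl _ hZ
  have hf₀nn : ∀ φ, 0 ≤ S.indicator W φ := fun φ =>
    Set.indicator_nonneg (fun ψ _ => (hWpos ψ).le) φ
  -- the sandwich `m f₀ ≤ f₁ ≤ M f₀`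
  have hδ1 : 0 < 1 + δ' := by linarith
  have hsand : ∀ φ, Θ₀ / (1 + δ') * S.indicator W φ ≤ f₁ φ ∧ f₁ φ ≤ (1 + δ') * Θ₀ * S.indicator W φ := by
    intro φ
    by_cases hφ : φ ∈ S
    · rw [hf₁, Set.indicator_of_mem hφ, Set.indicator_of_mem hφ]
      constructor
      · have h1 : Θ₀ / (1 + δ') ≤ Θ φ := by
          rw [div_le_iff₀ hδ1]; linarith [hlo φ hφ]
        nlinarith [hWpos φ]
      · nlinarith [hWpos φ, hup φ hφ]
    · rw [hf₁, Set.indicator_of_notMem hφ, Set.indicator_of_notMem hφ]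
      simp
  have hZ₀ : 0 < ∫ φ, S.indicator W φ := by
    have h1 : ∫ φ, f₁ φ ≤ ∫ φ, (1 + δ') * Θ₀ * S.indicator W φ :=
      integral_mono hi₁ (hi₀.const_mul _) fun φ => (hsand φ).2
    rw [integral_const_mul] at h1
    have h2 : 0 < (1 + δ') * Θ₀ := by positivity
    by_contra h3
    have h4 : (1 + δ') * Θ₀ * ∫ φ, S.indicator W φ ≤ 0 :=
      mul_nonpos_of_nonneg_of_nonpos h2.le (not_lt.1 h3)
    linarith
  -- comparison of the two normalised averages
  have hm : 0 < Θ₀ / (1 + δ') := by positivity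
  have key := ratio_perturb_le volume (S.indicator W) f₁ H (Θ₀ / (1 + δ')) ((1 + δ') * Θ₀) hm hf₀nn hsand
    hi₀ hi₁ hHm.aestronglyMeasurable hH1 hZ₀
  -- rewrite the regulated expectation through the folding identities
  have hE : LatticeSineGordon.expect α g ε ζ H = (∫ φ, H φ * f₁ φ) / ∫ φ, f₁ φ := by
    unfold LatticeSineGordon.expect LatticeSineGordon.partitionFunction
    rw [hnum, hden]
  have hflatnum : ∫ φ, S.indicator (fun φ => H φ * W φ) φ = ∫ φ, H φ * S.indicator W φ := by
    refine integral_congr_ae (Filter.Eventually.of_forall fun φ => ?_)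
    exact Set.indicator_mul_right S H W
  rw [hE, hflatnum]
  refine key.trans ?_
  -- `2 (M - m) / m = 2 ((1 + δ')² - 1) ≤ 6 δ' ≤ δ`
  have hval : 2 * ((1 + δ') * Θ₀ - Θ₀ / (1 + δ')) / (Θ₀ / (1 + δ')) = 2 * ((1 + δ') ^ 2 - 1) := by
    field_simp
  rw [hval]
  nlinarith

end Summit.QuantumFields.YangMills.Theorems.AnchorGap

end
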